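import Mathlib
import HarnessLib
import HarnessLib.Audit
import Summits.Parity.Statement
import HarnessLib.Audit.Status.Attr

/-!
Route: SelbergDelangeRigidity

DORMANT since 2026-08-22T02:08:24Z (reconciler: no traction for 5 d (last activity item-evidence-added at 2026-08-17T01:21:09Z); parked, not closed — `ledger route dormant route-Parity-SelbergDelangeRigidity --off` to reactivate) — unstaffed, not closed; items shared with open routes are served there. `ledger route dormant <id> --off` reactivates.

# Route SelbergDelangeRigidity — Selberg–Delange rigidity — Bateman–Horn as the z^k coefficient of
the law of z^Ω along f, by Vitali from a positive real segment plus one-sided bounds on a thin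
complex neighbourhood of [0, 7/4)

Realises card Parity/BatemanHorn/selberg-delange-rigidity for the FULL conjunct (all k, all systems
f = (f_1,…,f_k)), reopened after
route SelbergDelange (n²+1 only, ended at Conjecture E) was retired not-a-thesis. For a Bateman–Horn
system put Ω_f(n) := Σ_i Ω(f_i(n))
(prime factors WITH multiplicity, so that for n ≥ n₀(f) one has Ω_f(n) = k iff every f_i(n) is prime
— no prime-power or resultant
corrections), S_x(z) := Σ_{0≤n≤x} z^{Ω_f(n)} (a polynomial in z whose z^k-coefficient is
polyPrimeCount f x + O_f(1)), and the normalised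
entire family H_x(z) := x⁻¹ (log x)^{k(1−z)} S_x(z), D := ∏ deg f_i, C(f) := batemanHornConst f (the
ordered Euler product, PROVED convergent
and positive in the tree: IsBatemanHornSystem.hasBatemanHornConst_holds). It suffices to show X = X1
∧ X2:
X1 = NormalFamilyBound (rank 2): for some η ∈ (0, 1/4] the family {H_x}_x is locally bounded on the
thin rectangle V_η = {−η < Re z < 7/4,
|Im z| < η} (ONE-SIDED bounds ‖H_x(z)‖ ≤ M near each point, uniformly in x);
X2 = LSDRealSegment (rank 3): there is Λ holomorphic on |z| < 2 with Λ(0) = C(f) such that for REAL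
y ∈ (5/4, 7/4) (positive weights
y^{Ω_f(n)}, no cancellation anywhere) H_x(y) → Λ(y)·D^{y−1}/Γ(y)^k — the Landau–Selberg–Delange law
along f, whose conjectural Λ is the
Euler product λ_f(z) = ∏_p E_p(z)(1−1/p)^{k(z−1)}, E_p(z) = the mean of z^{Σ_i v_p(f_i(n))} over n
(E_p(0) = 1 − ω_f(p)/p exactly, so
λ_f(0) = C(f); E_p(1) = 1).
Given X, Vitali–Porter
(Literature.Analysis.Complex.exists_tendstoLocallyUniformlyOn_of_frequently_tendsto, PROVED in the
tree) continues
the convergence from the real segment to all of V_η ∋ 0 with all z-derivatives, and the k-th Taylor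
coefficient at the k-fold zero of
Γ(z)^{−k} is Bateman–Horn: k!⁻¹ H_x^{(k)}(0) = x⁻¹(log x)^k (polyPrimeCount f x + O((log log x)^k))
→ Λ(0)/D = C(f)/∏ deg f_i.
Lean: `(∀ (k : ℕ) (f : Fin k → Polynomial ℤ), Literature.NumberTheory.Sieve.IsBatemanHornSystem f →
∃ η : ℝ, 0 < η ∧ η ≤ 1 / 4 ∧ ∀ a ∈ {z : ℂ | -η < z.re ∧ z.re < 7 / 4 ∧ |z.im| < η}, ∃ M : ℝ, ∃ r >
(0 : ℝ), ∀ x : ℕ, ∀ z ∈ Metric.ball a r ∩ {z : ℂ | -η < z.re ∧ z.re < 7 / 4 ∧ |z.im| < η}, ‖(x :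
ℂ)⁻¹ * Complex.exp ((k : ℂ) * (1 - z) * (Real.log (Real.log x) : ℂ)) * ∑ n ∈ Finset.range (x + 1), z
^ (∑ i, ArithmeticFunction.cardFactors (((f i).eval (n : ℤ)).toNat))‖ ≤ M) ∧ (∀ (k : ℕ) (f : Fin k →
Polynomial ℤ), Literature.NumberTheory.Sieve.IsBatemanHornSystem f → ∃ Λ : ℂ → ℂ, DifferentiableOn ℂ
Λ (Metric.ball 0 2) ∧ Λ 0 = (Literature.NumberTheory.Sieve.batemanHornConst f : ℂ) ∧ ∀ y : ℝ, 5 / 4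
< y → y < 7 / 4 → Filter.Tendsto (fun x : ℕ => (x : ℂ)⁻¹ * Complex.exp ((k : ℂ) * (1 - (y : ℂ)) *
(Real.log (Real.log x) : ℂ)) * ∑ n ∈ Finset.range (x + 1), (y : ℂ) ^ (∑ i,
ArithmeticFunction.cardFactors (((f i).eval (n : ℤ)).toNat))) Filter.atTop (nhds (Λ y * Complex.exp
(((y : ℂ) - 1) * (Real.log (∏ i, ((f i).natDegree : ℝ)) : ℂ)) * (Complex.Gamma y)⁻¹ ^ k)))`

## Assembly
Pure logic, sorry-free in Sketch.lean / glue.lean (`theorem closes`): fix k, f, hf; LSDRealSegment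
gives Λ (holomorphic on |z|<2,
Λ(0) = C(f)) and convergence on the real segment; NormalFamilyBound gives η and local bounds on V_η;
VitaliExtraction turns these into
convergence of the k-th z-derivatives at 0; CoefficientExtraction turns that into
BatemanHornAsymptotic f. Quantified over (k, f) this is
Literature.NumberTheory.Sieve.BatemanHornConjecture = _root_.BatemanHorn.

Rationale: WHY THIS LINE. Mechanism (card selberg-delange-rigidity; Selberg1954, Tenenbaum2015 II.5–II.6,
HallTenenbaum1988 Thm 04 for f = X): embed the prime
count into the entire-function-valued statistic z ↦ H_x(z); the prime number theorem, Landau's π_j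
laws and Bateman–Horn are Taylor
coefficients of ONE analytic law at the zero of 1/Γ, and a compactness theorem (Vitali–Porter /
Montel, imported from complex function
theory and already proved in Literature.Analysis.Complex) does the gluing at theorem grade. The
split is into two obligations of
different shape: an ASYMPTOTIC only for positive weights on a real segment (a level-of-distribution
/ large-prime-factor problem of
Nair–Tenenbaum type, NairTenenbaum1998, Henriot2012, parity-invisible at leading order since 1±λ
reweightings move H_x(z) by
(log x)^{−2k Re z}), and mere UPPER BOUNDS on an arbitrarily thin complex neighbourhood of [0, 7/4),
where parity lives at the explicit
exchange rate (log x)^{k(|z|−Re z)} ≤ (log x)^{2.42 k η} — the cost of leaving the real axis is a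
continuous dial from 0, not a cliff.
Versus the retired route: general (k, f) with the exact multiplicity statistic Ω (extraction is
exact: no prime powers, no S-units),
U shrunk to a REAL segment (all sign/phase content moved into the one-sided crux), V's height a free
parameter, and a deciding theorem
`closes` reaching _root_.BatemanHorn. No other BatemanHorn route uses analytic continuation in an
auxiliary parameter; the negatives
index (1 entry, ShiftedMultiplicationTable) is not touched.

RANKED CRUXES. #2 NormalFamilyBound (crux) — for every Bateman–Horn system f = (f_1..f_k) there is η
∈ (0, 1/4] such that the family H_x(z) = x⁻¹(log x)^{k(1−z)} Σ_{n≤x} z^{Ω_f(n)} (x ∈ ℕ) is locally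
bounded on V_η = {−η < Re z < 7/4, |Im z| < η}: every a ∈ V_η has a ball on which ‖H_x(z)‖ ≤ M for
all x. On the real segment (0, 7/4) this is the Nair–Tenenbaum order of magnitude; off the axis it
asks a saving (log x)^{k(|z|−Re z)} over the trivial bound; for Re z ≤ 0 it is alternating
cancellation Σ_j π_j(x) z^j ≪ x(log x)^{k(Re z−1)} among the almost-prime counts π_j(x) = #{n ≤ x :
Ω_f(n) = j} (card item L2; the parity content of the route). [difficulty: open-problem] (why it
might fail: At z=−η it demands |Σ_j π_j(x)(−η)^j| ≪ x(log x)^(−k(1+η)): power-of-log cancellation in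
signed almost-prime counts along f (BH-with-log-saving strength); 1±λ reweightings show no Type-I
input gives it; one Ω-oscillation at a z₀ with Re z₀>0 kills the frame.) [NairTenenbaum1998,
Henriot2012, Tenenbaum2015, Selberg1954, Ford2004, HallTenenbaum1988]
#3 LSDRealSegment (crux) — for every Bateman–Horn system f there is Λ holomorphic on |z| < 2 with
Λ(0) = C(f) = batemanHornConst f such that for every real y ∈ (5/4, 7/4): x⁻¹(log x)^{k(1−y)}
Σ_{n≤x} y^{Ω_f(n)} → Λ(y)·D^{y−1}/Γ(y)^k, D = ∏ deg f_i (card item L1 on U ∩ ℝ; positive weights, no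
cancellation). Conjecturally Λ = λ_f(z) = ∏_p E_p(z)(1−1/p)^{k(z−1)} (ordered product; E_p(z) = mean
over n of z^{Σ_i v_p(f_i(n))}, radius ≥ 2 at p = 2, so λ_f is holomorphic on |z|<2 by the proved
convergence of Σ_p (ω_f(p)−k)/p); known cases: k ≤ 1 linear (Selberg–Delange in progressions; f = X
is HallTenenbaum1988 Thm 04 with Λ = ∏(1−z/p)⁻¹(1−1/p)^z), k = 0 trivial; numerically checked for
X²+1 (§ Cheapest falsifier). [difficulty: open-problem] (why it might fail: Needs the law of the
number of prime factors > x^(1−ε) of f_i(n) with geometric weights y vs y² (Poisson–Dirichlet along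
f): divisor data beyond level x, the Type-I₂ wall of arXiv:1908.08816 §4; only y=2 with τ has
Hooley's switching identity, and y=2 is outside V.) [HallTenenbaum1988, Selberg1954, Tenenbaum2015,
NairTenenbaum1998, Hooley1963, arXiv:1908.08816]
#9 VitaliExtraction (support) — pure complex analysis, specialised to the route's family: if Λ is
holomorphic on |z| < 2, 0 < η ≤ 1/4, the family H_x is locally bounded on V_η (ball form, as in
NormalFamilyBound) and H_x(y) → Ψ(y) := Λ(y)e^{(y−1)log D}(Γ(y)⁻¹)^k for real y ∈ (5/4, 7/4), then
iteratedDeriv k H_x 0 → iteratedDeriv k Ψ 0. Proof: each H_x is entire (x⁻¹ · exp(affine) ·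
polynomial), V_η is open convex ⊂ ball(0,2) ∋ 0, Ψ is holomorphic on ball(0,2)
(Complex.differentiable_one_div_Gamma), the segment accumulates at 3/2 ∈ V_η; apply
Literature.Analysis.Complex.exists_tendstoLocallyUniformlyOn_of_frequently_tendsto (Vitali, proved),
identify the limit with Ψ by AnalyticOnNhd.eqOn_of_preconnected_of_frequently_eq, then
TendstoLocallyUniformlyOn.deriv k times and evaluate at 0. [difficulty: provable-now] [Conway1978,
Tenenbaum2015]
#9 CoefficientExtraction (support) — bookkeeping at the k-fold zero: for a Bateman–Horn system f, Λ
holomorphic on |z|<2 with Λ(0) = C(f), and iteratedDeriv k H_x 0 → iteratedDeriv k Ψ 0 (Ψ as above),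
conclude BatemanHornAsymptotic f. Proof: (Γ(z)⁻¹)^k = z^k Γ(z+1)^{−k}
(Complex.one_div_Gamma_eq_self_mul_one_div_Gamma_add_one), so iteratedDeriv k Ψ 0 = k!·Λ(0)/D with D
= ∏ deg f_i ≥ 1; on the other side H_x(z) = x⁻¹ e^{a(1−z)} Σ_j π_j(x) z^j with a = k log log x, so
iteratedDeriv k H_x 0 = k! x⁻¹ (log x)^k Σ_{m≤k} (−a)^m/m! · π_{k−m}(x); each f_i is non-constant
with positive leading coefficient (a prime constant would be a fixed prime divisor), hence for n ≥
n₀(f) all f_i(n) ≥ 2 and Ω_f(n) = k iff all f_i(n) prime: π_j(x) ≤ n₀ for j < k and |π_k(x) −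
polyPrimeCount f x| ≤ 2n₀; so x⁻¹(log x)^k polyPrimeCount f x → C(f)/D with C(f) > 0
(IsBatemanHornSystem.hasBatemanHornConst_holds), which is the IsEquivalent of BatemanHornAsymptotic
(Fintype.card (Fin k) = k). [difficulty: provable-now] [Tenenbaum2015, BatemanHornMathComp1962,
AletheiaZomleferFukshanskyGarcia2020]

TWO-LAYER PLAN. Foreseen glued splits (k ≤ 3, depth 1), filed only when a crux moves:
NormalFamilyBound ⇐ [RealAxisOrder: bounds on V_η ∩ {Re z > 0},
the Nair–Tenenbaum half, where the needed saving is only (log x)^{k(|z|−Re z)} with |z|−Re z ≤ η²] →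
[LeftHalfNormality: −η < Re z ≤ 0, the
signed almost-prime cancellation] → NormalFamilyBound; LSDRealSegment ⇐ [EulerFactor: λ_f
holomorphic on |z|<2 with λ_f(0) = C(f),
λ_f(1) = 1 — provable bookkeeping once E_p is typed] → [RealSegmentLaw k = 1 (single f, first case
deg 2)] → [joint law for k ≥ 2] →
LSDRealSegment. A degree/k ladder (linear k = 1 known; X²+1; twins (X, X+2)) is the natural
special-case family.

KILL CRITERIA. NormalFamilyBound refuted by an Ω-result at some z₀ ∈ V_η with Re z₀ > 0 for some
Bateman–Horn system (a genuine (log x)^{k(|z|−Re z)}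
oscillation that does not cancel, for every η) ⇒ the rigidity mechanism is dead ⇒ close
`refuted:NormalFamilyBound` with the census of
which (f, z₀). Refuted only through Re z₀ ≤ 0 ⇒ that is an Ω-theorem against
Bateman–Horn-with-log-savings for almost-prime counts along f:
record it as negative knowledge against every BH-side route and close. LSDRealSegment refuted
because the real-segment limit exists but
is not of the form Λ(y)D^{y−1}/Γ(y)^k with Λ(0) = C(f) (wrong large-prime correction) ⇒ PIVOT by
`--restate` with the corrected limit
(the Vitali frame survives with any holomorphic limit whose k-th coefficient at 0 is C(f)/D — if the
corrected coefficient is NOT C(f)/D the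
route refutes BatemanHorn for that f and we file ¬BatemanHorn); refuted because the limit provably
fails to exist ⇒ close. A refutation
of VitaliExtraction / CoefficientExtraction is a bookkeeping error ⇒ restate 1:1. BatemanHorn proved
elsewhere moots the route.

NOT DECOMPOSED YET. The explicit Euler factor λ_f (needs a typed local mean E_p(z) = lim_N
N⁻¹Σ_{n<N} z^{Σ_i v_p(f_i(n))}; deliberately hidden behind ∃Λ so
that no bad-prime bookkeeping is load-bearing); the Nair–Tenenbaum real-axis order of magnitude
(known, would be support); the f = X
calibration (Selberg–Delange for integers, HallTenenbaum1988 Thm 04: LSDRealSegment ∧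
NormalFamilyBound hold for k = 1 linear — a
formalisation project, not a crux); the several-statistics variant (ω instead of Ω, or ∏_i
z_i^{Ω(f_i(n))} in k variables with Hartogs);
the card's second extraction principle (square-part moments of p−1 ⇒ π_{kX²+1} by uniqueness of
Dirichlet coefficients) — left on the card.

CHEAPEST FALSIFIER. Numerics on the real segment, which I RAN (folder lsd_check.py,
lsd_check_twins.py + outputs, 2026-08-15). (a) f = X²+1 (k=1, D=2),
Λ = λ(y) = ((1+y)/2)(1/2)^{y−1}∏_{p odd}[1 − ρ/p + ρ(1−1/p)(y/p)/(1−y/p)](1−1/p)^{y−1}, ρ =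
1+χ₋₄(p): at x = 2·10⁵, H_x(y)/[λ(y)2^{y−1}/Γ(y)] =
1.028, 1.0009, 1.011, 1.030 at y = 0.5, 1.25, 1.5, 1.75, each drifting to 1 as x doubles; λ(0) =
1.37274 vs C(X²+1) = 1.37281; π₁ = 12391
vs C·Σ 1/(2 log n) = 12379. (b) twins f = (X, X+2) (k=2, D=1, E_2(y) = 1/2 + y³/(2(2−y))): at x =
10⁶, H/[λ/Γ²] = 1.038, 0.975, 0.915,
0.725 at the same y, all monotonically approaching 1 (slowly at y = 1.75 where E_2 = 11.2 inflates
the O(1/log x) terms); λ(0) = 2C₂ =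
1.32032 exactly; π₂ = 8169 vs 8250. A missing D^{y−1} or Γ-power would be off by ≥ 19 %. Next
cheapest for a refuter: a cubic f; complex
z = 1.5 + 0.2i and z = −0.2 up to x = 10⁷ (is sup_x ‖H_x(z)‖ visibly bounded?). Lookup falsifier: an
LSD-type ASYMPTOTIC (not order of
magnitude) for Σ y^{Ω(f(n))}, deg f ≥ 2, y ≠ 2, anywhere in print would make LSDRealSegment(k=1)
`known` — none found (§ Novelty).

NUMBERS. Exchange rate: trivial bound ‖H_x(z)‖ ≪ (log x)^{k(|z|−Re z)}; on V_η, |z| − Re z ≤ η(1+√2)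
(corner −η ± iη) — for η = 1/4 at most
(log x)^{0.61k}; near Re z = 7/4 only (log x)^{kη²/3.5}. Known anchor: f = X, Σ_{n≤x} y^{Ω(n)} =
x(log x)^{y−1}(H(y)/Γ(y) + O(1/log x)),
H(y) = ∏(1−y/p)⁻¹(1−1/p)^y, 0 < |y| < 2 (HallTenenbaum1988 Thm 04, PDF p. 11; Tenenbaum2015 II.6).
C(X²+1) = 1.3728134; λ(1) = 1 and
Λ'(1)+log D+kγ = the Mertens constant of Σ_n Ω_f(n) − k x log log x (open beyond leading order for
deg ≥ 2: largest prime factor of n²+1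
only known > x^{1.279} infinitely often, arXiv:1908.08816). Items at open: 5 (2 cruxes, 2 supports,
1 assembly).

DEFINITION REQUESTS. None load-bearing: everything is stated over Mathlib
(ArithmeticFunction.cardFactors, Complex.Gamma, iteratedDeriv) and
Literature.NumberTheory.Sieve (IsBatemanHornSystem, batemanHornConst, BatemanHornAsymptotic).
Optional later (tenure): a typed local
mean `lsdLocalFactor f p z` under Summits/Parity/BatemanHorn/Theorems to state the explicit λ_f as a
support item.

Novelty: Searches (2026-08-15): `lit search --hybrid "Selberg-Delange method polynomial values number of
prime factors asymptotic"` (12 book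
hits, all integer-LSD / sieve textbooks: Harman, Bordellès, Hooley, Ivić); `lit vsearch "asymptotic
formula for Σ z^Ω(f(n)), f irreducible,
by the Selberg–Delange method"` (10 hits, Ivić/Hooley/Harman, none on polynomial values); `lit
galaxy search "Selberg-Delange method"
--star all` (14 rows: Kowalski's Probabilistic NT, Bordellès, Tenenbaum arXiv:2409.02754, Singha Roy
arXiv:2401.00358 on residue-class
distribution of polynomially-defined multiplicative functions — none an LSD law along f(n)); `lit
search --source zbmath` ×2 and
`--source arxiv` ×2 ("Selberg-Delange polynomial values": 1 hit arXiv:2401.00358; "prime factors of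
polynomial values Erdős–Kac": 0);
`lit frontier Parity --since 2020` (30 descendants; arXiv:2605.01155 Bateman–Horn statistics sets,
nothing on LSD along f);
`lit read book:hall1988-divisors --grep` (Thm 04 = the f = X law); card audit (refuter, 2026-08-15):
zbMATH ×3, 0 hits.
Nearest prior art found: Selberg1954 / Tenenbaum2015 II.5–II.6 / HallTenenbaum1988 Thm 04 (the z^Ω
method and coefficient extraction for
the INTEGERS); NairTenenbaum1998 + Henriot2012 (order of magnitude only, for Σ F(|Q(n)|));
Hooley1963 (y = 2, τ(n²+1)); arXiv:0807.4739
(mod-Poisson convergence, integers/function fields); arXiv:1908.08816 (the level-x wall for n²+1).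
Delta: no LSD-type asymptotic for Σ z^{Ω(f(n))}, deg f ≥ 2, is proved or posed i  [refs: 2409.02754, 2401.00358, 2605.01155, 0807.4739, 1908.08816, book:hall1988-divisors, Selberg1954, Tenenbaum2015, HallTenenbaum1988, NairTenenbaum1998, Henriot2012, Hooley1963]

Barriers (technique_class: analytic-continuation normal-families selberg-delange): - technique_class: analytic-continuation normal-families selberg-delange
- Literature.Barriers.Parity.SelbergParityBarrier: APPLIES to NormalFamilyBound on Re z ≤ 0 and is
NOT evaded there — reweighting the values by 1 ± λ changes Σ z^{Ω_f} by a term of relative size (log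
x)^{−2k Re z}, which violates the bound exactly when Re z ≤ 0, so that crux is where non-Type-I
input must enter (honestly ranked 2, open-problem); it does NOT apply to LSDRealSegment (real y ≥
5/4: the same computation shows conspiracies invisible at leading order). The route's claim is the
clean, quantified SEPARATION, not an evasion.
- Literature.Barriers.Parity.FordFixedLevelBarrier: not engaged literally (no Λ_k-asymptotic is
drawn from fixed-level Type-I data); in substance LSDRealSegment needs divisor information on f_i(n)
beyond level x (rough cofactors with weights y vs y²) and names that as its content rather than
assuming a level.
- Literature.Barriers.Parity.FordMaynardMinimalTypeII: applies to any Type-I/II DERIVATION of primes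
in the thin sets {f(n)}; the route never detects primes by (I)/(II) — the prime count is a Taylor
coefficient of a family whose positive part is an unsigned statistic and whose signed part is only
bounded; honest form: NormalFamilyBound does not evade it, it asks for less than an asymptotic.
- Literature.Barriers.Parity.FordMaynardLowLevel: same status as FordMaynardMinimalTypeII — the
low-level prime-free sequences constrain Type-I/II derivations, which no item performs;

History (route lifecycle, newest last):
- 2026-08-22T02:08:24Z · DORMANT — reconciler: no traction for 5 d (last activity item-evidence-added at 2026-08-17T01:21:09Z); parked, not closed — `ledger route dormant route-Parity-SelbergDela (operator:999:1021100)

sub-problem: BatemanHorn · status: dormant · opened planner-plancard-Parity-BatemanHorn-selberg-d-4cfb6f54-0 2026-08-15T14:23:13Z · rev 1 · ledger route-Parity-SelbergDelangeRigidity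
GENERATED by the gate from the ledger (D-0016/17). Provers cite these decls: `theorem foo : Summit.Parity.BatemanHorn.Theses.SelbergDelangeRigidity.<Decl> := …` in Summits/Parity/BatemanHorn/Theorems/<Name>.lean.
-/

namespace Summit.Parity.BatemanHorn.Theses.SelbergDelangeRigidity

open scoped BigOperators Topology Manifold Classical MeasureTheory ProbabilityTheory Matrix InnerProductSpace ComplexConjugate ContinuousMap
open Filter Set Function TopologicalSpace MeasureTheory

attribute [summit_statement] _root_.BatemanHorn

/-- item stmt-Parity-9769 · crux · rank 2 · open · by planner
why it might fail: At z=−η it demands |Σ_j π_j(x)(−η)^j| ≪ x(log x)^(−k(1+η)): power-of-log cancellation in signed almost-prime counts along f (BH-with-log-saving strength); 1±λ reweightings show no Type-I input gives it; one Ω-oscillation at a z₀ with Re z₀>0 kills the frame.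
sources: NairTenenbaum1998, Henriot2012, Tenenbaum2015, Selberg1954, Ford2004, HallTenenbaum1988
[crux] for every Bateman–Horn system f = (f_1..f_k) there is η ∈ (0, 1/4] such that the family
H_x(z) = x⁻¹(log x)^{k(1−z)} Σ_{n≤x} z^{Ω_f(n)} (x ∈ ℕ) is locally bounded on V_η = {−η < Re z <
7/4, |Im z| < η}: every a ∈ V_η has a ball on which ‖H_x(z)‖ ≤ M for all x. On the real segment (0,
7/4) this is the Nair–Tenenbaum order of magnitude; off the axis it asks a saving (log x)^{k(|z|−Re
z)} over the trivial bound; for Re z ≤ 0 it is alternating cancellation Σ_j π_j(x) z^j ≪ x(log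
x)^{k(Re z−1)} among the almost-prime counts π_j(x) = #{n ≤ x : Ω_f(n) = j} (card item L2; the
parity content of the route). [difficulty: open-problem] -/
@[route_item "route-Parity-SelbergDelangeRigidity", crux]
def NormalFamilyBound : Prop :=
  ∀ (k : ℕ) (f : Fin k → Polynomial ℤ), Literature.NumberTheory.Sieve.IsBatemanHornSystem f → ∃ η : ℝ, 0 < η ∧ η ≤ 1 / 4 ∧ ∀ a ∈ {z : ℂ | -η < z.re ∧ z.re < 7 / 4 ∧ |z.im| < η}, ∃ M : ℝ, ∃ r > (0 : ℝ), ∀ x : ℕ, ∀ z ∈ Metric.ball a r ∩ {z : ℂ | -η < z.re ∧ z.re < 7 / 4 ∧ |z.im| < η}, ‖(x : ℂ)⁻¹ * Complex.exp ((k : ℂ) * (1 - z) * (Real.log (Real.log x) : ℂ)) * ∑ n ∈ Finset.range (x + 1), z ^ (∑ i, ArithmeticFunction.cardFactors (((f i).eval (n : ℤ)).toNat))‖ ≤ M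

/-- item stmt-Parity-9770 · crux · rank 3 · open · by planner
why it might fail: Needs the law of the number of prime factors > x^(1−ε) of f_i(n) with geometric weights y vs y² (Poisson–Dirichlet along f): divisor data beyond level x, the Type-I₂ wall of arXiv:1908.08816 §4; only y=2 with τ has Hooley's switching identity, and y=2 is outside V.
sources: HallTenenbaum1988, Selberg1954, Tenenbaum2015, NairTenenbaum1998, Hooley1963, arXiv:1908.08816
[crux] for every Bateman–Horn system f there is Λ holomorphic on |z| < 2 with Λ(0) = C(f) =
batemanHornConst f such that for every real y ∈ (5/4, 7/4): x⁻¹(log x)^{k(1−y)} Σ_{n≤x} y^{Ω_f(n)} →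
Λ(y)·D^{y−1}/Γ(y)^k, D = ∏ deg f_i (card item L1 on U ∩ ℝ; positive weights, no cancellation).
Conjecturally Λ = λ_f(z) = ∏_p E_p(z)(1−1/p)^{k(z−1)} (ordered product; E_p(z) = mean over n of
z^{Σ_i v_p(f_i(n))}, radius ≥ 2 at p = 2, so λ_f is holomorphic on |z|<2 by the proved convergence
of Σ_p (ω_f(p)−k)/p); known cases: k ≤ 1 linear (Selberg–Delange in progressions; f = X is
HallTenenbaum1988 Thm 04 with Λ = ∏(1−z/p)⁻¹(1−1/p)^z), k = 0 trivial; numerically checked for X²+1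
(§ Cheapest falsifier). [difficulty: open-problem] -/
@[route_item "route-Parity-SelbergDelangeRigidity", crux]
def LSDRealSegment : Prop :=
  ∀ (k : ℕ) (f : Fin k → Polynomial ℤ), Literature.NumberTheory.Sieve.IsBatemanHornSystem f → ∃ Λ : ℂ → ℂ, DifferentiableOn ℂ Λ (Metric.ball 0 2) ∧ Λ 0 = (Literature.NumberTheory.Sieve.batemanHornConst f : ℂ) ∧ ∀ y : ℝ, 5 / 4 < y → y < 7 / 4 → Filter.Tendsto (fun x : ℕ => (x : ℂ)⁻¹ * Complex.exp ((k : ℂ) * (1 - (y : ℂ)) * (Real.log (Real.log x) : ℂ)) * ∑ n ∈ Finset.range (x + 1), (y : ℂ) ^ (∑ i, ArithmeticFunction.cardFactors (((f i).eval (n : ℤ)).toNat))) Filter.atTop (nhds (Λ y * Complex.exp (((y : ℂ) - 1) * (Real.log (∏ i, ((f i).natDegree : ℝ)) : ℂ)) * (Complex.Gamma y)⁻¹ ^ k))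

/-- item stmt-Parity-9771 · support · rank 9 · closed · proved by Summit.Parity.BatemanHorn.Theorems.vitaliExtraction_proof @ b3031e5444aa (prover) · by planner
sources: Conway1978, Tenenbaum2015
[support] pure complex analysis, specialised to the route's family: if Λ is holomorphic on |z| < 2,
0 < η ≤ 1/4, the family H_x is locally bounded on V_η (ball form, as in NormalFamilyBound) and
H_x(y) → Ψ(y) := Λ(y)e^{(y−1)log D}(Γ(y)⁻¹)^k for real y ∈ (5/4, 7/4), then iteratedDeriv k H_x 0 →
iteratedDeriv k Ψ 0. Proof: each H_x is entire (x⁻¹ · exp(affine) · polynomial), V_η is open convex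
⊂ ball(0,2) ∋ 0, Ψ is holomorphic on ball(0,2) (Complex.differentiable_one_div_Gamma), the segment
accumulates at 3/2 ∈ V_η; apply
Literature.Analysis.Complex.exists_tendstoLocallyUniformlyOn_of_frequently_tendsto (Vitali, proved),
identify the limit with Ψ by AnalyticOnNhd.eqOn_of_preconnected_of_frequently_eq, then
TendstoLocallyUniformlyOn.deriv k times and evaluate at 0. [difficulty: provable-now] -/
@[route_item "route-Parity-SelbergDelangeRigidity", crux]
def VitaliExtraction : Prop :=
  ∀ (k : ℕ) (f : Fin k → Polynomial ℤ) (Λ : ℂ → ℂ) (η : ℝ), 0 < η → η ≤ 1 / 4 → DifferentiableOn ℂ Λ (Metric.ball 0 2) → (∀ a ∈ {z : ℂ | -η < z.re ∧ z.re < 7 / 4 ∧ |z.im| < η}, ∃ M : ℝ, ∃ r > (0 : ℝ), ∀ x : ℕ, ∀ z ∈ Metric.ball a r ∩ {z : ℂ | -η < z.re ∧ z.re < 7 / 4 ∧ |z.im| < η}, ‖(x : ℂ)⁻¹ * Complex.exp ((k : ℂ) * (1 - z) * (Real.log (Real.log x) : ℂ)) * ∑ n ∈ Finset.range (x + 1),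 z ^ (∑ i, ArithmeticFunction.cardFactors (((f i).eval (n : ℤ)).toNat))‖ ≤ M) → (∀ y : ℝ, 5 / 4 < y → y < 7 / 4 → Filter.Tendsto (fun x : ℕ => (x : ℂ)⁻¹ * Complex.exp ((k : ℂ) * (1 - (y : ℂ)) * (Real.log (Real.log x) : ℂ)) * ∑ n ∈ Finset.range (x + 1), (y : ℂ) ^ (∑ i, ArithmeticFunction.cardFactors (((f i).eval (n : ℤ)).toNat))) Filter.atTop (nhds (Λ y * Complex.exp (((y : ℂ) - 1) * (Real.log (∏ i, ((f i).natDegree : ℝ)) : ℂ)) * (Complex.Gamma y)⁻¹ ^ k))) → Filter.Tendsto (fun x : ℕ => iteratedDeriv k (fun z : ℂ => (x : ℂ)⁻¹ * Complex.exp ((k : ℂ) * (1 - z) * (Real.log (Real.log x) : ℂ)) * ∑ n ∈ Finset.range (x + 1), z ^ (∑ i, ArithmeticFunction.cardFactors (((f i).eval (n : ℤ)).toNat))) 0) Filter.atTop (nhds (iteratedDeriv k (fun z : ℂ => Λ z * Complex.exp ((z - 1) * (Real.log (∏ i, ((f i).natDegree : ℝ)) : ℂ)) * (Complex.Gamma z)⁻¹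 ^ k) 0))

/-- item stmt-Parity-9772 · support · rank 9 · closed · proved by Summit.Parity.BatemanHorn.Theorems.coefficientExtraction_proof (prover) · by planner
sources: Tenenbaum2015, BatemanHornMathComp1962, AletheiaZomleferFukshanskyGarcia2020
[support] bookkeeping at the k-fold zero: for a Bateman–Horn system f, Λ holomorphic on |z|<2 with
Λ(0) = C(f), and iteratedDeriv k H_x 0 → iteratedDeriv k Ψ 0 (Ψ as above), conclude
BatemanHornAsymptotic f. Proof: (Γ(z)⁻¹)^k = z^k Γ(z+1)^{−k}
(Complex.one_div_Gamma_eq_self_mul_one_div_Gamma_add_one), so iteratedDeriv k Ψ 0 = k!·Λ(0)/D with D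
= ∏ deg f_i ≥ 1; on the other side H_x(z) = x⁻¹ e^{a(1−z)} Σ_j π_j(x) z^j with a = k log log x, so
iteratedDeriv k H_x 0 = k! x⁻¹ (log x)^k Σ_{m≤k} (−a)^m/m! · π_{k−m}(x); each f_i is non-constant
with positive leading coefficient (a prime constant would be a fixed prime divisor), hence for n ≥
n₀(f) all f_i(n) ≥ 2 and Ω_f(n) = k iff all f_i(n) prime: π_j(x) ≤ n₀ for j < k and |π_k(x) −
polyPrimeCount f x| ≤ 2n₀; so x⁻¹(log x)^k polyPrimeCount f x → C(f)/D with C(f) > 0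
(IsBatemanHornSystem.hasBatemanHornConst_holds), which is the IsEquivalent of BatemanHornAsymptotic
(Fintype.card (Fin k) = k). [difficulty: provable-now] -/
@[route_item "route-Parity-SelbergDelangeRigidity", crux]
def CoefficientExtraction : Prop :=
  ∀ (k : ℕ) (f : Fin k → Polynomial ℤ), Literature.NumberTheory.Sieve.IsBatemanHornSystem f → ∀ Λ : ℂ → ℂ, DifferentiableOn ℂ Λ (Metric.ball 0 2) → Λ 0 = (Literature.NumberTheory.Sieve.batemanHornConst f : ℂ) → Filter.Tendsto (fun x : ℕ => iteratedDeriv k (fun z : ℂ => (x : ℂ)⁻¹ * Complex.exp ((k : ℂ) * (1 - z) * (Real.log (Real.log x) : ℂ)) * ∑ n ∈ Finset.range (x + 1), z ^ (∑ i, ArithmeticFunction.cardFactors (((f i).eval (n : ℤ)).toNat))) 0) Filter.atTop (nhds (iteratedDeriv k (fun z : ℂ => Λ z * Complex.exp ((z - 1) * (Real.log (∏ i, ((f i).natDegree : ℝ)) : ℂ)) * (Complex.Gamma z)⁻¹ ^ k) 0)) → Literature.NumberTheory.Sieve.BatemanHornAsymptotic f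

/-- item stmt-Parity-9773 · assembly · rank 1 · closed · proved by Summit.Parity.BatemanHorn.Theorems.selbergDelangeRigidityAssembly_proof (prover) · by planner
sources: Selberg1954, Tenenbaum2015
[assembly] NormalFamilyBound → LSDRealSegment → VitaliExtraction → CoefficientExtraction →
BatemanHorn. -/
@[route_item "route-Parity-SelbergDelangeRigidity"]
def Assembly : Prop :=
  NormalFamilyBound → LSDRealSegment → VitaliExtraction → CoefficientExtraction → _root_.BatemanHorn

/-! D-0027 §2.1 — DECIDING THEOREM (planner-authored via `route open/edit --closes-file`; by planner-plancard-Parity-BatemanHorn-selberg-d-4cfb6f54-0 2026-08-15T14:23:14Z):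
its hypotheses are this route's items and its conclusion the sub-problem Statement (glue_lint), and it elaborates with this file. -/

@[closes "route-Parity-SelbergDelangeRigidity"] theorem closes (hN : NormalFamilyBound) (hL : LSDRealSegment) (hV : VitaliExtraction) (hE : CoefficientExtraction) : _root_.BatemanHorn := by
  intro k f hf
  obtain ⟨Λ, hΛ, hΛ0, hU⟩ := hL k f hf
  obtain ⟨η, hη, hη4, hB⟩ := hN k f hf
  exact hE k f hf Λ hΛ hΛ0 (hV k f Λ η hη hη4 hΛ hB hU)

end Summit.Parity.BatemanHorn.Theses.SelbergDelangeRigidity
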